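import Summits.AtomisticToContinuum.Crystallization.Theorems.FrustratedLawDichotomyStrainedPatchHomEntrySymBox
import Summits.AtomisticToContinuum.Crystallization.Theorems.FrustratedLawDichotomyStrainedPatchHomEntrySixHcp

/-!
# `(H)`: the six/nine-coordinate certificate statements OF RECORD with the best fcc verdict and the sharp hcp verdict (critic row 848 successor)

decomp-a2c hand-2 g23 (crux `AperiodicFrustratedLawGap`, stmt-AtomisticToContinuum-27623).  Critic row 848 fixed the `(H)` certificate statement of
record as hand-1's `…HomEntrySixHcp.homFloor_625_of_entrySearches66` (fcc `entryLeafOK6 = entryLeafOKD ∘ symIdx`, hcp `entryLeafOKH6 = entryLeafOKH2 ∘ symIdxH`,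
selectors `rr6` / `rr9H`) and asked for the successor `entryLeafOK6B μ c w := entryLeafOKDB μ (c ∘ symIdx) (w ∘ symIdx)` + `homFloor_625_of_sixBestSearches66`.
`…HomEntrySymBox` (written concurrently) delivers exactly that verdict under the name `entryLeafOKDBs` (and the sharp hcp one `entryLeafOKH3s`) through its
own mirror-reader `symU`; this file IDENTIFIES the two conventions and states the closing forms in the record's vocabulary:

* §1 `symU c = c ∘ symIdx`, `symH c = c ∘ symIdxH`, `SymBox.rr6 = EntrySix.rr6`, `SymBox.rr9H = EntrySixHcp.rr9H` (all definitional), hence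
  `entryLeafOKDBs μ c w = entryLeafOKDB μ (c ∘ symIdx) (w ∘ symIdx)` (= the requested `entryLeafOK6B`, no third name introduced) and
  `entryLeafOKH3s μ c w = entryLeafOKH3 μ (c ∘ symIdxH) (w ∘ symIdxH)`;
* §2 ★★★ `homFloor_625_of_sixBestSearches66` (fcc `entryLeafOKDBs` = fundamental domain × best fit, hcp hand-1's `entryLeafOKH6`),
  ★★★ `homFloor_625_of_sixBestSharpSearches66` (hcp `entryLeafOKH3s` = sharp fit — the verdict that closes the measured basal-shear (P1)/(P4) gap, see
  `…HomEntryFitHcpSharpKit`), the generic-`m` form and the `1/1000` (`muMilli`) twins.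

No definitions; 0 sorry; standard axioms.  `--supports stmt-AtomisticToContinuum-27623`.
-/

namespace Summit.AtomisticToContinuum.Crystallization.Theorems.FrustratedLawDichotomyStrainedPatchHomEntrySixBest

open scoped BigOperators RealInnerProductSpace
open Literature.Analysis.ValidatedNumerics.Numerics
open Summit.AtomisticToContinuum.Crystallization.Theorems.FrustratedLawDichotomyStrainedPatchHomSplit
open Summit.AtomisticToContinuum.Crystallization.Theorems.FrustratedLawDichotomyStrainedPatchHomPrunedPolar (homFloor_of_prunedBoxSums_selfAdjoint)
open Summit.AtomisticToContinuum.Crystallization.Theorems.FrustratedLawDichotomyStrainedPatchHomEntryGram (rootC rootW)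
open Summit.AtomisticToContinuum.Crystallization.Theorems.FrustratedLawDichotomyStrainedPatchHomEntryGramHcp (rootCH rootWH)
open Summit.AtomisticToContinuum.Crystallization.Theorems.FrustratedLawDichotomyStrainedPatchHomEntryTable (muRec muRec_ok)
open Summit.AtomisticToContinuum.Crystallization.Theorems.FrustratedLawDichotomyStrainedPatchHomEntrySearch (searchOK)
open Summit.AtomisticToContinuum.Crystallization.Theorems.FrustratedLawDichotomyStrainedPatchHomEntryDomBest (entryLeafOKDB)
open Summit.AtomisticToContinuum.Crystallization.Theorems.FrustratedLawDichotomyStrainedPatchHomEntryFitHcpSharp (entryLeafOKH3)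
open Summit.AtomisticToContinuum.Crystallization.Theorems.FrustratedLawDichotomyStrainedPatchHomEntrySymBox
  (symU symH entryLeafOKDBs entryLeafOKH3s fccHalf_of_entrySearchSym hcpHalf_of_entrySearchSym)
open Summit.AtomisticToContinuum.Crystallization.Theorems.FrustratedLawDichotomyStrainedPatchHomEntrySix (symIdx muMilli muMilli_ok)
open Summit.AtomisticToContinuum.Crystallization.Theorems.FrustratedLawDichotomyStrainedPatchHomEntrySixHcp (symIdxH entryLeafOKH6 hcpHalf_of_entrySearchH6)

/-! ## §1. The two mirror conventions coincide -/

/-- `symU c = c ∘ symIdx`. [formal bookkeeping] -/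
theorem symU_eq_comp_symIdx (c : Fin 3 × Fin 3 → ℤ) : symU c = c ∘ symIdx := by
  funext ab
  simp only [Function.comp_apply, symU, symIdx]
  split_ifs <;> rfl

/-- `symH c = c ∘ symIdxH`. [formal bookkeeping] -/
theorem symH_eq_comp_symIdxH (c : (Fin 3 × Fin 3) ⊕ Fin 3 → ℤ) : symH c = c ∘ symIdxH := by
  funext k
  rcases k with ab | i
  · show symU (fun ab' => c (Sum.inl ab')) ab = c (symIdxH (Sum.inl ab))
    rw [symU_eq_comp_symIdx]; rfl
  · rfl

/-- The two six-coordinate fcc selectors are the same function. [formal bookkeeping] -/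
theorem rr6_eq : FrustratedLawDichotomyStrainedPatchHomEntrySymBox.rr6 = FrustratedLawDichotomyStrainedPatchHomEntrySix.rr6 := rfl

/-- The two nine-coordinate hcp selectors are the same function. [formal bookkeeping] -/
theorem rr9H_eq : FrustratedLawDichotomyStrainedPatchHomEntrySymBox.rr9H = FrustratedLawDichotomyStrainedPatchHomEntrySixHcp.rr9H := rfl

/-- ★ `entryLeafOKDBs` IS the requested `entryLeafOK6B` (critic row 848): `entryLeafOKDB μ (c ∘ symIdx) (w ∘ symIdx)`. [formal bookkeeping] -/
theorem entryLeafOKDBs_eq (μ : ℤ) (c w : Fin 3 × Fin 3 → ℤ) : entryLeafOKDBs μ c w = entryLeafOKDB μ (c ∘ symIdx) (w ∘ symIdx) := by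
  unfold entryLeafOKDBs; rw [symU_eq_comp_symIdx, symU_eq_comp_symIdx]

/-- ★ `entryLeafOKH3s μ c w = entryLeafOKH3 μ (c ∘ symIdxH) (w ∘ symIdxH)`. [formal bookkeeping] -/
theorem entryLeafOKH3s_eq (μ : ℤ) (c w : (Fin 3 × Fin 3) ⊕ Fin 3 → ℤ) : entryLeafOKH3s μ c w = entryLeafOKH3 μ (c ∘ symIdxH) (w ∘ symIdxH) := by
  unfold entryLeafOKH3s; rw [symH_eq_comp_symIdxH, symH_eq_comp_symIdxH]

/-! ## §2. The certificate statements of record -/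

/-- ★★★ **`(H) HomFloor m` from the six-coordinate fcc search with the BEST fcc verdict and the nine-coordinate hcp search with hand-1's `entryLeafOKH6`**
(any selectors; every `m`, `μ` with `2 (m + e_W) SC ≤ μ`). [folklore] -/
theorem homFloor_of_sixBestSearches66 {m : ℝ} {μ : ℤ} (hμ : 2 * (m + (-(7175 / 10000) + 3 / 400)) * SC ≤ μ)
    {selF : ℕ → (Fin 3 × Fin 3 → ℤ) → (Fin 3 × Fin 3 → ℤ) → Fin 3 × Fin 3} {fuelF dF : ℕ}
    (hF : searchOK (entryLeafOKDBs μ) selF fuelF dF rootC rootW = true)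
    {selH : ℕ → ((Fin 3 × Fin 3) ⊕ Fin 3 → ℤ) → ((Fin 3 × Fin 3) ⊕ Fin 3 → ℤ) → (Fin 3 × Fin 3) ⊕ Fin 3} {fuelH dH : ℕ}
    (hH : searchOK (entryLeafOKH6 μ) selH fuelH dH rootCH rootWH = true) : HomFloor m :=
  homFloor_of_prunedBoxSums_selfAdjoint (fccHalf_of_entrySearchSym hμ hF) (hcpHalf_of_entrySearchH6 hμ hH)

/-- ★★★ **`(H) HomFloor (1/625)` — record successor (critic row 848)**: `searchOK (entryLeafOKDBs muRec) rr6 …` ∧ `searchOK (entryLeafOKH6 muRec) rr9H …`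
(the selectors of `…HomEntrySix` / `…HomEntrySixHcp`). [folklore] -/
theorem homFloor_625_of_sixBestSearches66 {fuelF fuelH : ℕ}
    (hF : searchOK (entryLeafOKDBs muRec) FrustratedLawDichotomyStrainedPatchHomEntrySix.rr6 fuelF 0 rootC rootW = true)
    (hH : searchOK (entryLeafOKH6 muRec) FrustratedLawDichotomyStrainedPatchHomEntrySixHcp.rr9H fuelH 0 rootCH rootWH = true) : HomFloor (1 / 625) :=
  homFloor_of_sixBestSearches66 muRec_ok hF hH

/-- ★★★ **`(H) HomFloor (1/625)` with the SHARP hcp verdict**: `searchOK (entryLeafOKDBs muRec) rr6 …` ∧ `searchOK (entryLeafOKH3s muRec) rr9H …` — the hcp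
search that can terminate across the basal-shear (P1)/(P4) window (see `…HomEntryFitHcpSharpKit`). [folklore] -/
theorem homFloor_625_of_sixBestSharpSearches66 {fuelF fuelH : ℕ}
    (hF : searchOK (entryLeafOKDBs muRec) FrustratedLawDichotomyStrainedPatchHomEntrySix.rr6 fuelF 0 rootC rootW = true)
    (hH : searchOK (entryLeafOKH3s muRec) FrustratedLawDichotomyStrainedPatchHomEntrySixHcp.rr9H fuelH 0 rootCH rootWH = true) : HomFloor (1 / 625) :=
  homFloor_of_prunedBoxSums_selfAdjoint (fccHalf_of_entrySearchSym muRec_ok hF) (hcpHalf_of_entrySearchSym muRec_ok hH)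

/-- ★★★ The `1/1000` twin (`μ = muMilli`) with hand-1's hcp verdict. [folklore] -/
theorem homFloor_milli_of_sixBestSearches66 {fuelF fuelH : ℕ}
    (hF : searchOK (entryLeafOKDBs muMilli) FrustratedLawDichotomyStrainedPatchHomEntrySix.rr6 fuelF 0 rootC rootW = true)
    (hH : searchOK (entryLeafOKH6 muMilli) FrustratedLawDichotomyStrainedPatchHomEntrySixHcp.rr9H fuelH 0 rootCH rootWH = true) : HomFloor (1 / 1000) :=
  homFloor_of_sixBestSearches66 muMilli_ok hF hH

/-- ★★★ The `1/1000` twin (`μ = muMilli`) with the sharp hcp verdict. [folklore] -/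
theorem homFloor_milli_of_sixBestSharpSearches66 {fuelF fuelH : ℕ}
    (hF : searchOK (entryLeafOKDBs muMilli) FrustratedLawDichotomyStrainedPatchHomEntrySix.rr6 fuelF 0 rootC rootW = true)
    (hH : searchOK (entryLeafOKH3s muMilli) FrustratedLawDichotomyStrainedPatchHomEntrySixHcp.rr9H fuelH 0 rootCH rootWH = true) : HomFloor (1 / 1000) :=
  homFloor_of_prunedBoxSums_selfAdjoint (fccHalf_of_entrySearchSym muMilli_ok hF) (hcpHalf_of_entrySearchSym muMilli_ok hH)

end Summit.AtomisticToContinuum.Crystallization.Theorems.FrustratedLawDichotomyStrainedPatchHomEntrySixBest
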